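import Summits.MatrixMultiplication.OmegaCensus.STPPSmallPatternCriteria

/-!
# ω-census, `(2,1,1)^k` STPP families: the TWO-LAYER ('domino') template over an index-2 subgroup

HONEST FRAMING (pub-omega census; verbatim): lottery ticket; floor = certified bounds/negative ranges.
Census STRUCTURE bookkeeping (STRUCTURE §1 B5, the T1 onset column; ENG1 gen 31 memo `T1-ONSET-MEMO.md` §3, 2026-08-28), not progress
on `ω`: a `(2,1,1)^k` family certifies no matrix-multiplication bound by itself.

The template.  In `H = ℤ/2 × G` take pairs straddling the two cosets of `G`, `Aₗ = {(0, σₗ), (1, σ'ₗ)}`, `Bₗ = {0}`, and points in the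
subgroup, `Cₗ = {(0, γₗ)}`.  Then `cⱼ − cₗ ∈ G`, and of the four differences `x − y` (`x ∈ Aᵢ`, `y ∈ Aₗ`) only the two same-layer ones lie
in `G`, so CKSU Def. 5.1 (via the kernel criterion `isSTPP_pairPoint_iff`) collapses EXACTLY to a system in `G` alone:

  `σ`, `σ'` injective and `γⱼ − γₗ ∉ {σᵢ − σₗ} ∪ {σ'ᵢ − σ'ₗ}` for all `i` and all `j ≠ l`

(`isSTPP_layered_iff`).  Taking `σ' := σ` ('domino': all gaps equal to the involution direction) loses nothing for EXISTENCE
(`exists_layered_iff_exists_domino`), and a domino solution in `G` gives a `(2,1,1)^k` host `ℤ/2 × G` (`exists_isSTPP_211_prod_of_domino`).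
With `τₗ := γₗ − σₗ` the domino system says: each of the `k` matched differences `γₗ − σₗ` is represented exactly once in the difference table
`{γⱼ − σᵢ}` — the 'uniquely-represented matching' form searched completely by ENG1's `layer2.c` / `gdom.c` (template onsets `6, 14, 18, 26,
36, 42` for `k = 2 … 7` in cyclic `G`; EMPTY in every abelian `G` of order 18 at `k = 7` — engine statements, NOT claimed here).
No onset, minimality or threshold claim is made by this file.

References: H. Cohn, R. Kleinberg, B. Szegedy, C. Umans, *Group-theoretic algorithms for matrix multiplication*, FOCS 2005
(arXiv:math/0511460), Def. 5.1.  Seat pub-omega-eng1 (gen 31), 2026-08-28.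
-/

open Literature.Computability.AlgebraicComplexity Finset

namespace Summit.MatrixMultiplication.OmegaCensus

variable {G : Type*} [AddCommGroup G] [DecidableEq G] {k : ℕ}

/-- **The two-layer template is a system in the index-2 subgroup.**  For `Aₗ = {(0, σₗ), (1, σ'ₗ)}`, `Bₗ = {0}`, `Cₗ = {(0, γₗ)}` in
`ℤ/2 × G`: CKSU Def. 5.1 ⟺ (`σᵢ ≠ σₗ` and `σ'ᵢ ≠ σ'ₗ` for `i ≠ l`) ∧ (`γⱼ − γₗ ≠ σᵢ − σₗ` and `γⱼ − γₗ ≠ σ'ᵢ − σ'ₗ` for all `i`, all `j ≠ l`).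
[cite: CohnKleinbergSzegedyUmans2005, Def. 5.1] -/
theorem isSTPP_layered_iff (σ σ' γ : Fin k → G) :
    IsSTPP (fun i => ({((0 : ZMod 2), σ i), (1, σ' i)} : Finset (ZMod 2 × G))) (fun _ => ({0} : Finset (ZMod 2 × G)))
        (fun i => ({((0 : ZMod 2), γ i)} : Finset (ZMod 2 × G))) ↔
      (∀ i l : Fin k, i ≠ l → σ i ≠ σ l ∧ σ' i ≠ σ' l) ∧
      (∀ i j l : Fin k, j ≠ l → γ j - γ l ≠ σ i - σ l ∧ γ j - γ l ≠ σ' i - σ' l) := by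
  have h01 : (0 : ZMod 2) ≠ 1 := by decide
  have h10 : (1 : ZMod 2) - 0 ≠ 0 - 0 := by decide
  have h01' : (0 : ZMod 2) - 1 ≠ 0 - 0 := by decide
  rw [isSTPP_pairPoint_iff]
  refine and_congr (forall_congr' fun i => forall_congr' fun l => forall_congr' fun _ => ?_)
    (forall_congr' fun i => forall_congr' fun j => forall_congr' fun l => forall_congr' fun _ => ?_)
  · -- disjointness of the two straddling pairs
    rw [Finset.disjoint_insert_left, Finset.disjoint_singleton_left, Finset.mem_insert, Finset.mem_singleton,
      Finset.mem_insert, Finset.mem_singleton]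
    simp only [Prod.mk.injEq, h01, h01.symm, false_and, or_false, false_or, true_and]
  · -- the difference condition: only the two same-layer differences can hit `(0, γ j - γ l)`
    constructor
    · intro h
      refine ⟨fun e => ?_, fun e => ?_⟩
      · exact h (0, σ i) (by simp) (0, σ l) (by simp) (by rw [Prod.mk_sub_mk, Prod.mk_sub_mk, e])
      · exact h (1, σ' i) (by simp) (1, σ' l) (by simp) (by rw [Prod.mk_sub_mk, Prod.mk_sub_mk, sub_self, sub_self, e])
    · rintro ⟨h1, h2⟩ x hx y hy hxy
      rw [Finset.mem_insert, Finset.mem_singleton] at hx hy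
      rcases hx with rfl | rfl <;> rcases hy with rfl | rfl <;>
        rw [Prod.mk_sub_mk, Prod.mk_sub_mk, Prod.mk.injEq] at hxy
      · exact h1 hxy.2.symm
      · exact h01' hxy.1
      · exact h10 hxy.1
      · exact h2 hxy.2.symm

omit [DecidableEq G] in
/-- **Two-layer ⟺ domino for existence.**  If the two-layer system has a solution `(σ, σ', γ)` then `(σ, σ, γ)` is one with equal layers,
and conversely; so the template's reach (in any `G`, any `k`) is that of its 'domino' sub-case `σ' = σ`. [cite: CohnKleinbergSzegedyUmans2005, Def. 5.1] -/
theorem exists_layered_iff_exists_domino :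
    (∃ σ σ' γ : Fin k → G, (∀ i l : Fin k, i ≠ l → σ i ≠ σ l ∧ σ' i ≠ σ' l) ∧
        ∀ i j l : Fin k, j ≠ l → γ j - γ l ≠ σ i - σ l ∧ γ j - γ l ≠ σ' i - σ' l) ↔
      ∃ σ γ : Fin k → G, (∀ i l : Fin k, i ≠ l → σ i ≠ σ l) ∧
        ∀ i j l : Fin k, j ≠ l → γ j - γ l ≠ σ i - σ l := by
  constructor
  · rintro ⟨σ, σ', γ, hinj, hd⟩
    exact ⟨σ, γ, fun i l h => (hinj i l h).1, fun i j l h => (hd i j l h).1⟩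
  · rintro ⟨σ, γ, hinj, hd⟩
    exact ⟨σ, σ, γ, fun i l h => ⟨hinj i l h, hinj i l h⟩, fun i j l h => ⟨hd i j l h, hd i j l h⟩⟩

/-- **A domino solution in `G` makes `ℤ/2 × G` a `(2,1,1)^k` host** (the existential size-pattern form used by the census rows and by
`exists_isSTPP_222_of_211`): pairs `{(0, σₗ), (1, σₗ)}`, `Bₗ = {0}`, `Cₗ = {(0, γₗ)}`. [cite: CohnKleinbergSzegedyUmans2005, Def. 5.1] -/
theorem exists_isSTPP_211_prod_of_domino (σ γ : Fin k → G) (hinj : ∀ i l : Fin k, i ≠ l → σ i ≠ σ l)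
    (hd : ∀ i j l : Fin k, j ≠ l → γ j - γ l ≠ σ i - σ l) :
    ∃ A B C : Fin k → Finset (ZMod 2 × G), IsSTPP A B C ∧ ∀ i, (A i).card = 2 ∧ (B i).card = 1 ∧ (C i).card = 1 := by
  refine ⟨fun i => {((0 : ZMod 2), σ i), (1, σ i)}, fun _ => {0}, fun i => {((0 : ZMod 2), γ i)},
    (isSTPP_layered_iff σ σ γ).mpr ⟨fun i l h => ⟨hinj i l h, hinj i l h⟩, fun i j l h => ⟨hd i j l h, hd i j l h⟩⟩, fun i => ?_⟩
  have h01 : (0 : ZMod 2) ≠ 1 := by decide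
  have hne : ((0 : ZMod 2), σ i) ≠ (1, σ i) := fun e => h01 (congrArg Prod.fst e)
  exact ⟨card_pair hne, card_singleton _, card_singleton _⟩

end Summit.MatrixMultiplication.OmegaCensus
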